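import Literature.AlgebraicGeometry.Motives.TrivialLocusFieldDescent
import Literature.AlgebraicGeometry.Motives.SeesawTrivialLocusRationalPoint
import Literature.AlgebraicGeometry.Motives.AbelianVarietyTranslationInvariantAmple
import Literature.AlgebraicGeometry.Motives.SemicontinuityGrothendieckComplexProofs
import Literature.AlgebraicGeometry.Motives.AbelianVarietyQuotientAction
import Literature.AlgebraicGeometry.Motives.AbelianVarietyWeilPairingBaseChange
import HarnessLib

/-!
# The transporter `{x | t_x^*Θ − Θ ∼ D}` of an abelian variety is closed and descends its points: a solution over an extension
# field gives a rational solution over an algebraically closed ground field ([MumfordAV1970] §8, §10 seesaw; [GortzWedhorn2023] Thm. 24.66 (1))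

Layer `Literature/AlgebraicGeometry/Motives`, namespaces `Literature.AlgebraicGeometry.Motives.CartierDivisor` (§1) and
`Literature.AlgebraicGeometry.Motives.AbelianVariety` (§2–§3).  THEOREMS ONLY (no definition, no named fact, no instance, no notation, no `sorry`).

* §1 **`CartierDivisor.apply_mem_trivialLocus_iff_of_fieldPoint`** (generic) — the trivial locus `Z(D) ⊆ T` of a divisor `D` on `P ×_K T`
  (`P → Spec K` proper, geometrically integral) is READ AT A FIELD-VALUED POINT `ŷ : Spec L → T` over `K` (any extension `L ⊇ K`):
  `ŷ(pt) ∈ Z(D) ↔ (P × ŷ)^*D ∼ 0` on `P ×_K Spec L` — the trivial locus is compatible with base change along `ŷ` (★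
  `preimage_trivialLocus_eq`, [GortzWedhorn2023] Thm. 24.66 (1)) and on the one-point base `Spec L` triviality of the fibre class over
  `κ(pt) = L` is triviality (descent ★ `linEquiv_zero_of_classPullback_whiskerLeft_fieldExt` along `κ(pt) ⊇ L`, ascent by pull-back).
  The case `L = K` is ★ `mem_trivialLocus_iff_classPullback_slice_linEquiv_zero`.
* §2 `AbelianVariety.classPullback_transporterDiv_linEquiv` — the slice formula for `E = m^*Θ − p₁^*Θ − p₁^*D` on `B × B` along
  `φ = (x₁, x₂) : T → B × B`: `φ^*E ∼ (x₁x₂)^*Θ − x₁^*Θ − x₁^*D` (as ★ `classPullback_mumfordDiv_linEquiv`).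
* §3 **`AbelianVariety.exists_linEquiv_weilDiv_of_baseChange`** — TRANSPORTER DESCENT: for `B` over an ALGEBRAICALLY CLOSED `K`, `Θ, D` on `B`,
  an extension `L ⊇ K` with projection `pr₁ : B_L → B`, and an `L`-point `a ∈ B_L(L)` with `pr₁^*D ∼ t_a^*(pr₁^*Θ) − pr₁^*Θ`, there is a
  `K`-point `z ∈ B(K)` with `D ∼ t_z^*Θ − Θ`: the set `Z(E) = {x | t_x^*Θ − Θ − D ∼ 0 on B_{κ(x)}}` is CLOSED (seesaw ★
  `seesaw_isClosed_trivialLocus_holds`), contains the image of `a` (§1 + ★ `transl_fst`), hence a closed point, which is `K`-rational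
  (`K = K̄`) and reads `t_z^*Θ − Θ − D ∼ 0` (★ `mem_trivialLocus_iff_classPullback_slice_linEquiv_zero`).

Purpose (cell `hodgecm-mathlib`, FLOOR 0 ∕ P1, F-3 (M) book, (Mc) input (H0) by TRANSPORT, census
`B-provers/B-p09/g17/CENSUS-F3Mc-H0-transport.B-p09g17.md`, file 3 of 5): bringing the point `a ∈ A_ℂ(ℂ)` given by [MumfordAV1970] §8 Theorem 1
over `ℂ` back to the countable algebraically closed field `K₂ ⊆ Ω`.  HC_CM is proved only modulo the 7 printed citations until rung 0 closes;
nothing here bears on a summit statement.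

## References
* [MumfordAV1970] D. Mumford, *Abelian Varieties* (1970), §8 (the map `Λ(L)`, p. 74), §10 (seesaw, p. 89).
* [GortzWedhorn2023] U. Görtz, T. Wedhorn, *Algebraic Geometry II* (2023), Thm. 24.66 (1) (p. 405), Lemma 24.65 (p. 405), Def. 27.1 (pp. 604–605).
-/

open CategoryTheory CategoryTheory.Limits AlgebraicGeometry MonoidalCategory CartesianMonoidalCategory
open TopologicalSpace Topology

noncomputable section

namespace Literature.AlgebraicGeometry.Motives

open scoped MonObj

universe u

/-! ## §1 The trivial locus read at a field-valued point -/

namespace CartierDivisor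

variable {K : Type u} [Field K] (P T : SchemeOver K) [IsProper P.hom] [GeometricallyIntegral P.hom]
  [IsIntegral (P ⊗ T).left] {L : Type u} [Field L] [Algebra K L] [IsIntegral (P ⊗ specOver K L).left]

/-- **The trivial locus at a field-valued point.** For `P → Spec K` proper and geometrically integral, a `K`-scheme `T`, a divisor `D` on
`P ×_K T` and an `L`-valued point `ŷ : Spec L → T` over `K` (`L ⊇ K` any extension): the point `ŷ(pt)` of `T` lies in the trivial locus
`Z(D)` iff `(P × ŷ)^*D ∼ 0` on `P ×_K Spec L`.  (★ `preimage_trivialLocus_eq`: `ŷ⁻¹Z(D) = Z((P × ŷ)^*D) ⊆ Spec L`; on the one-point base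
triviality of the fibre class over `κ(pt) ⊇ L` descends, ★ `linEquiv_zero_of_classPullback_whiskerLeft_fieldExt`, and ascends by pull-back.)
[cite: GortzWedhorn2023, Thm. 24.66 (1) (p. 405) and Lemma 24.65 (p. 405)] -/
theorem apply_mem_trivialLocus_iff_of_fieldPoint (D : CartierDivisor (P ⊗ T).left) (ŷ : specOver K L ⟶ T)
    (pt : (specOver K L).left) :
    ŷ.left pt ∈ trivialLocus P T D ↔ (D.classPullback (P ◁ ŷ).left).LinEquiv 0 := by
  have hpre := preimage_trivialLocus_eq P ŷ D
  constructor
  · intro h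
    have h1 : pt ∈ trivialLocus P (specOver K L) (D.classPullback (P ◁ ŷ).left) := by
      rw [← hpre]; exact h
    rw [mem_trivialLocus_iff] at h1
    -- descend along `Spec κ(pt) → Spec L`
    exact linEquiv_zero_of_classPullback_whiskerLeft_fieldExt P (residuePtι (specOver K L) pt) _ h1
  · intro h
    have h1 : pt ∈ trivialLocus P (specOver K L) (D.classPullback (P ◁ ŷ).left) := by
      rw [trivialLocus_eq_univ_of_linEquiv_zero h]; trivial
    rw [← hpre] at h1
    exact h1

end CartierDivisor

/-! ## §2 The transporter divisor `E = m^*Θ − p₁^*Θ − p₁^*D` and its slices -/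

namespace AbelianVariety

variable {K : Type u} [Field K] (B : AbelianVariety K)

/-- **Slice formula for the transporter divisor.** For `E = m^*Θ − p₁^*Θ − p₁^*D` on `B × B` (divisor classes) and
`φ = (x₁, x₂) : T → B × B` over `K`: `φ^*E ∼ (x₁x₂)^*Θ − x₁^*Θ − x₁^*D` (so on the slice `B × {x}` it is `t_x^*Θ − Θ − D`, and on
the slice `{x₁} × B` through an `L`-point it reads translation by that point) — as ★ `classPullback_mumfordDiv_linEquiv`.
[cite: MumfordAV1970, §8 (the map `Λ(L)`, p. 74)] [cite: GortzWedhorn2023, Def. 27.1 (pp. 604–605)] -/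
theorem classPullback_transporterDiv_linEquiv {T : SchemeOver K} [IsIntegral T.left]
    (Θ D : CartierDivisor B.X.left) (φ : T ⟶ B.X ⊗ B.X) :
    ((Θ.classPullback (μ[B.X]).left +
        (-(Θ.classPullback (CartesianMonoidalCategory.fst B.X B.X).left) +
          -(D.classPullback (CartesianMonoidalCategory.fst B.X B.X).left))).classPullback φ.left).LinEquiv
      (Θ.classPullback ((φ ≫ CartesianMonoidalCategory.fst _ _) * (φ ≫ CartesianMonoidalCategory.snd _ _)).left +
        (-(Θ.classPullback (φ ≫ CartesianMonoidalCategory.fst _ _).left) +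
          -(D.classPullback (φ ≫ CartesianMonoidalCategory.fst _ _).left))) := by
  have hμ : (φ ≫ CartesianMonoidalCategory.fst _ _) * (φ ≫ CartesianMonoidalCategory.snd _ _) =
      φ ≫ μ[B.X] := by
    rw [← MonObj.comp_mul, Hom.mul_def, CartesianMonoidalCategory.lift_fst_snd, Category.id_comp]
  have hc : ∀ (F : CartierDivisor B.X.left) (g : B.X ⊗ B.X ⟶ B.X),
      ((F.classPullback g.left).classPullback φ.left).LinEquiv (F.classPullback (φ ≫ g).left) := fun F g => by
    rw [Over.comp_left]; exact (F.classPullback_comp_linEquiv g.left φ.left).symm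
  have hn : ∀ (F : CartierDivisor B.X.left) (g : B.X ⊗ B.X ⟶ B.X),
      ((-(F.classPullback g.left)).classPullback φ.left).LinEquiv (-(F.classPullback (φ ≫ g).left)) := fun F g =>
    (CartierDivisor.classPullback_neg_linEquiv φ.left _).trans (hc F g).neg
  refine (CartierDivisor.classPullback_add_linEquiv φ.left _ _).trans ?_
  refine ((hc Θ _).add ((CartierDivisor.classPullback_add_linEquiv φ.left _ _).trans
    ((hn Θ _).add (hn D _)))).trans ?_
  rw [hμ]
  exact CartierDivisor.LinEquiv.refl _

/-- Divisor algebra: `X + (−A + −C) ∼ 0` when `C ∼ X + −A`. [cite: GortzWedhorn2020, Section (11.9) (p. 301)] -/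
private theorem add_neg_add_neg_linEquiv_zero {Y : Scheme.{u}} [IsIntegral Y] {X A C : CartierDivisor Y}
    (hC : C.LinEquiv (X + -A)) : (X + (-A + -C)).LinEquiv 0 :=
  (((CartierDivisor.LinEquiv.refl X).add ((CartierDivisor.LinEquiv.refl (-A)).add hC.neg)).trans
    (CartierDivisor.add_assoc_sameDivisor X (-A) (-(X + -A))).linEquiv.symm).trans
    (CartierDivisor.add_neg_sameDivisor (X + -A)).linEquiv

/-- Divisor algebra: from `X + (−A + −C) ∼ 0`, `C ∼ X + −A`. [cite: GortzWedhorn2020, Section (11.9) (p. 301)] -/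
private theorem linEquiv_add_neg_of_add_neg_add_neg_linEquiv_zero {Y : Scheme.{u}} [IsIntegral Y] {X A C : CartierDivisor Y}
    (h : (X + (-A + -C)).LinEquiv 0) : C.LinEquiv (X + -A) :=
  (CartierDivisor.LinEquiv.of_add_neg
    ((CartierDivisor.add_assoc_sameDivisor X (-A) (-C)).linEquiv.trans h)).symm

/-! ## §3 Transporter descent: a solution of `t_x^*Θ − Θ ∼ D` over an extension field gives a rational one over `K = K̄` -/

section Transporter

variable [IsAlgClosed K] (L : Type u) [Field L] [Algebra K L]

/-- **Transporter descent** ([MumfordAV1970] §8, §10): `B` an abelian variety over an ALGEBRAICALLY CLOSED field `K`, `Θ`, `D` Cartier divisors on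
`B`, `L ⊇ K` a field extension with projection `pr₁ : B_L → B`, and `a ∈ B_L(L)` with `pr₁^*D ∼ t_a^*(pr₁^*Θ) − pr₁^*Θ`.  Then `D ∼ t_z^*Θ − Θ`
for some `z ∈ B(K)`.  Proof: the trivial locus `Z ⊆ B` of `E = m^*Θ − p₁^*Θ − p₁^*D` over `p₂` is CLOSED (seesaw ★
`seesaw_isClosed_trivialLocus_holds`); it contains the image of `a` (§1 at the field point `ā : Spec L → B`, the slice being
`t_a^*Θ_L − Θ_L − D_L ∼ 0` by ★ `transl_fst`); a non-empty closed subset of the Jacobson space `B` contains a closed point `z`, which is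
`K`-rational (`K = K̄`), and at a rational point `Z` reads `t_z^*Θ − Θ − D ∼ 0` (★ `mem_trivialLocus_iff_classPullback_slice_linEquiv_zero`).
[cite: MumfordAV1970, §8 (p. 74) and §10 (seesaw, p. 89)] [cite: GortzWedhorn2023, Thm. 24.66 (1) (p. 405) and Def. 27.1 (pp. 604–605)] -/
theorem exists_linEquiv_weilDiv_of_baseChange (Θ D : CartierDivisor B.X.left)
    (π : (B.baseChange L).X.left ⟶ B.X.left) (hπ : π = pullback.fst B.X.hom (bcSpec K L)) [IsDominant π]
    (a : (B.baseChange L).Points L) (ha : (D.pullback π).LinEquiv ((B.baseChange L).weilDiv (Θ.pullback π) a)) :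
    ∃ z : B.Points K, D.LinEquiv (B.weilDiv Θ z) := by
  subst hπ
  haveI hdomT : IsDominant ((B.baseChange L).translation a).left :=
    AbelianVariety.isDominant_translation_left (B.baseChange L) a
  haveI : IsIntegral (B.X ⊗ specOver K L).left := inferInstanceAs (IsIntegral (B.baseChange L).X.left)
  -- the transporter divisor and its (closed) trivial locus
  set E : CartierDivisor (B.X ⊗ B.X).left := Θ.classPullback (μ[B.X]).left +
    (-(Θ.classPullback (CartesianMonoidalCategory.fst B.X B.X).left) +
      -(D.classPullback (CartesianMonoidalCategory.fst B.X B.X).left)) with hE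
  have hZ : IsClosed (CartierDivisor.trivialLocus B.X B.X E) := seesaw_isClosed_trivialLocus_holds K B.X B.X E
  -- the `L`-point `a` as a field-valued point `s : Spec L → B` over `K`
  set s : B.Points L := (B.pointsMulEquiv L).symm a with hs_def
  have hsa : B.pointsMulEquiv L s = a := (B.pointsMulEquiv L).apply_symm_apply a
  -- `t_a ≫ pr₁ = (ā ∘ pr₂) · pr₁` (★ `transl_fst`)
  have ht : ((B.baseChange L).translation a).left ≫ pullback.fst B.X.hom (bcSpec K L) =
      (B.constPt L s * B.fstPt L).left := by
    have h := B.transl_fst L s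
    dsimp only [AbelianVariety.transl] at h
    rwa [hsa] at h
  -- Step A: the image of `a` lies in `Z(E)` — the slice of `E` along `B × s` is `t_a^*Θ_L − Θ_L − D_L ∼ 0`
  have hA : s.left (IsLocalRing.closedPoint L) ∈ CartierDivisor.trivialLocus B.X B.X E := by
    rw [CartierDivisor.apply_mem_trivialLocus_iff_of_fieldPoint B.X B.X E s]
    have hslice := B.classPullback_transporterDiv_linEquiv Θ D (B.X ◁ s)
    rw [CartesianMonoidalCategory.whiskerLeft_fst, CartesianMonoidalCategory.whiskerLeft_snd] at hslice
    refine hslice.trans ?_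
    -- identify the three terms with divisors on `B_L`
    have hfst : (CartesianMonoidalCategory.fst B.X (specOver K L)).left = pullback.fst B.X.hom (bcSpec K L) := rfl
    have hprod : (CartesianMonoidalCategory.fst B.X (specOver K L) *
        (CartesianMonoidalCategory.snd B.X (specOver K L) ≫ s)).left =
        ((B.baseChange L).translation a).left ≫ pullback.fst B.X.hom (bcSpec K L) := by
      refine Eq.trans ?_ ht.symm
      rw [mul_comm (B.constPt L s) (B.fstPt L)]
      rfl
    rw [hprod, hfst]
    -- `X + (−A + −C) ∼ 0` with `X ∼ t_a^*Θ_L`, `A ∼ Θ_L`, `C ∼ D_L` and `D_L ∼ t_a^*Θ_L − Θ_L`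
    have eΘ := Θ.classPullback_linEquiv_pullback (pullback.fst B.X.hom (bcSpec K L))
    have eD := D.classPullback_linEquiv_pullback (pullback.fst B.X.hom (bcSpec K L))
    have eX : (Θ.classPullback (((B.baseChange L).translation a).left ≫
        pullback.fst B.X.hom (bcSpec K L))).LinEquiv
        (@CartierDivisor.pullback _ _ (Θ.pullback (pullback.fst B.X.hom (bcSpec K L))) _ _
          ((B.baseChange L).translation a).left hdomT) :=
      ((Θ.classPullback_comp_linEquiv (pullback.fst B.X.hom (bcSpec K L))
          ((B.baseChange L).translation a).left).trans (eΘ.classPullback _)).trans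
        (@CartierDivisor.classPullback_linEquiv_pullback _ _ _ _ ((B.baseChange L).translation a).left hdomT
          (Θ.pullback (pullback.fst B.X.hom (bcSpec K L))))
    refine ((eX.add (eΘ.neg.add eD.neg)).trans ?_)
    exact add_neg_add_neg_linEquiv_zero ha
  -- Step B: a closed point `z ∈ Z(E)`
  haveI : JacobsonSpace B.X.left := LocallyOfFiniteType.jacobsonSpace B.X.hom
  obtain ⟨z, hzZ, hzc⟩ := nonempty_inter_closedPoints ⟨_, hA⟩ hZ.isLocallyClosed
  -- Step C: `z` is `K`-rational and `Z(E)` at `z` reads `t_z^*Θ − Θ − D ∼ 0`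
  let t₀ : 𝟙_ (SchemeOver K) ⟶ B.X := Over.homMk (pointOfClosedPoint B.X.hom z hzc) (by simp)
  have ht₀ : t₀.left (IsLocalRing.closedPoint K) = z := pointOfClosedPoint_apply B.X.hom z hzc _
  have e0 : CartesianMonoidalCategory.toUnit B.X ≫ t₀ = toSpecOver B.X ≫ B.pointOfClosed z hzc := by
    ext1
    rw [Over.comp_left, Over.comp_left, Over.toUnit_left, toSpecOver_left]
    rfl
  have e : (𝟙 B.X) * (CartesianMonoidalCategory.toUnit _ ≫ t₀) = B.translation (B.pointOfClosed z hzc) := by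
    unfold translation
    rw [mul_comm, e0]
  rw [← ht₀] at hzZ
  have hs := CartierDivisor.classPullback_slice_linEquiv_zero_of_mem_trivialLocus B.X B.X hzZ
  have hslice := B.classPullback_transporterDiv_linEquiv Θ D ((ρ_ B.X).inv ≫ B.X ◁ t₀)
  have e1 : ((ρ_ B.X).inv ≫ B.X ◁ t₀) ≫ CartesianMonoidalCategory.fst _ _ = 𝟙 _ := by simp
  have e2 : ((ρ_ B.X).inv ≫ B.X ◁ t₀) ≫ CartesianMonoidalCategory.snd _ _ = CartesianMonoidalCategory.toUnit _ ≫ t₀ := by simp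
  rw [e1, e2, e, Over.id_left] at hslice
  have h0 := hslice.symm.trans hs
  -- `t_z^*Θ + (−Θ + −D) ∼ 0` (class pull-backs) ⇒ `D ∼ t_z^*Θ − Θ`
  refine ⟨B.pointOfClosed z hzc, ?_⟩
  have eT := Θ.classPullback_linEquiv_pullback (B.translation (B.pointOfClosed z hzc)).left
  have eI := Θ.classPullback_id_linEquiv
  have eDI := D.classPullback_id_linEquiv
  have h1 : ((Θ.pullback (B.translation (B.pointOfClosed z hzc)).left) + (-Θ + -D)).LinEquiv 0 :=
    ((eT.symm.add (eI.symm.neg.add eDI.symm.neg)).trans h0)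
  exact linEquiv_add_neg_of_add_neg_add_neg_linEquiv_zero h1

end Transporter

end AbelianVariety

end Literature.AlgebraicGeometry.Motives

end
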